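import Literature.AlgebraicGeometry.Motives.AimedSplitProductProofs
import Literature.AlgebraicGeometry.Motives.HyperbolicWeilTypeProduct
import Literature.AlgebraicGeometry.HodgeTheory.WeilSurfaceCMSquare
import Literature.AlgebraicGeometry.HodgeTheory.AbelianVarietyEndomorphismsHOne
import Literature.AlgebraicGeometry.HodgeTheory.HodgeTypeConjugation
import Literature.AlgebraicGeometry.HodgeTheory.HodgeTypeExteriorProduct
import HarnessLib

/-!
# `H¹ = H^{1,0} ⊕ H^{0,1}` on the carriers: the subspaces, eigenvector multiplicities of an endomorphism, conjugation, products

Family `hodge`, layer `Literature/AlgebraicGeometry/HodgeTheory`. Bookkeeping for the degree-one Hodge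
structure `H¹(X(ℂ); ℂ) = H^{1,0} ⊕ H^{0,1}` of a smooth projective `X` on the tree's carriers
(`complexBetti X 1`, `IsOfHodgeType n X 1 1 0 / 1 0 1`), together with an endomorphism `g : X ⟶ X`:
the "`K`-multiplicities" of an abelian variety of Weil type (van Geemen, LNM 1594, 4.9 and Lemma 5.2
(1): the dimensions `(p, q)` of `H^{1,0} ∩ V₊` and `H^{0,1} ∩ V₊` for the eigenspace `V₊` of `φ^*`),
read in general:

* `hodgeOneZero hX`, `hodgeZeroOne hX` — `H^{1,0}`, `H^{0,1} ⊆ H¹(X(ℂ); ℂ)` as `ℂ`-submodules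
  (closed under sums by `IsOfHodgeType.add`, all Hodge models cutting out the same pieces);
  `isCompl_hodgeOneZero_hodgeZeroOne` — `H¹ = H^{1,0} ⊕ H^{0,1}` (Voisin I §6.1.3, Cor. 6.14; the
  tree's `exists_add_eq_of_isOfHodgeType_one`, `eq_zero_of_isOfHodgeType_one_zero_of_zero_one`);
* `map_mem_hodgeOneZero/ZeroOne` (`g^*` preserves types, Voisin I §7.3.2),
  `conjClass_mem_…` (conjugation swaps them, Cor. 6.12);
* `eigenvector_components` — the `(1,0)`- and `(0,1)`-components of an eigenvector of `g^*` are
  eigenvectors (same eigenvalue); `eigenspace_eq_sup`, `finrank_eigenspace_eq_add` —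
  `V_μ = (V_μ ∩ H^{1,0}) ⊕ (V_μ ∩ H^{0,1})`, `dim V_μ = p_μ + q_μ`;
* `finrank_eq_of_conjClass_mapsTo` — two subspaces exchanged by complex conjugation have the same
  dimension (conjugation is a conjugate-linear bijection; count real dimensions);
  `finrank_eigenspace_inf_hodgeZeroOne_eq` — `q_{μ̄} … = p_μ`: `dim (V_{conj μ} ∩ H^{0,1}) =
  dim (V_μ ∩ H^{1,0})` (`g^*` is real, `conjClass_map`);
* products of abelian varieties `A × B` with `φ × ψ`: `eigenspace_inf_hodgeOneZero_prod_eq_sup`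
  and `finrank_eigenspace_inf_hodgeOneZero_prod` (and the `(0,1)` twins) — **the multiplicities
  add**, `p_μ(A × B) = p_μ(A) + p_μ(B)` (Künneth in degree one on the carriers,
  `exists_eq_map_fst_add_map_snd_deg_one`, the sections `(𝟙, 0)`, `(0, 𝟙)`, and type preservation).

No named fact is introduced (D-0026); the two `def`s are submodules (carriers `{x | IsOfHodgeType …}`).

## References

* [VoisinHodgeI2002] C. Voisin, Hodge Theory and Complex Algebraic Geometry I (CUP 2002), §6.1.3
  Cor. 6.12, Cor. 6.14, §7.1.1, §7.3.2, §11.3.3 (Künneth).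
* [vanGeemen1994HodgeAV] B. van Geemen, An introduction to the Hodge conjecture for abelian
  varieties, LNM 1594 (1994), 4.9, Lemma 5.2 (1).
* [LangeBirkenhake1992] H. Lange, Ch. Birkenhake, Complex Abelian Varieties (1992), §1.1, Thm. 4.2.1.
-/

noncomputable section

open CategoryTheory
open Literature.AlgebraicTopology.SingularHomology
open Literature.AlgebraicGeometry.Motives (IsSmoothProjective)

namespace Literature.AlgebraicGeometry.HodgeTheory

section HodgeTheory

/-! ### Conjugation exchanges dimensions -/

section Conj

variable {Y : Type} [TopologicalSpace Y] {k : ℕ}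

/-- **Two `ℂ`-subspaces of `Hᵏ(Y; ℂ)` exchanged by complex conjugation of coefficients have the same
dimension**: conjugation restricts to an `ℝ`-linear bijection between them, and
`dim_ℝ = 2 dim_ℂ`. [cite: VoisinHodgeI2002, §6.1.3 Cor. 6.12] -/
theorem finrank_eq_of_conjClass_mapsTo (S₁ S₂ : Submodule ℂ (singularCohomology ℂ ℂ Y k))
    [FiniteDimensional ℂ S₁] [FiniteDimensional ℂ S₂]
    (h₁ : ∀ x ∈ S₁, conjClass Y k x ∈ S₂) (h₂ : ∀ x ∈ S₂, conjClass Y k x ∈ S₁) :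
    Module.finrank ℂ S₁ = Module.finrank ℂ S₂ := by
  let f : S₁ ≃ₗ[ℝ] S₂ :=
    { toFun := fun x ↦ ⟨conjClass Y k x, h₁ x x.2⟩
      map_add' := fun x y ↦ Subtype.ext (conjClass_add _ _)
      map_smul' := fun r x ↦ Subtype.ext (by
        change conjClass Y k (((r : ℂ)) • (x : singularCohomology ℂ ℂ Y k)) =
          (r : ℂ) • conjClass Y k (x : singularCohomology ℂ ℂ Y k)
        rw [conjClass_smul, Complex.conj_ofReal])
      invFun := fun y ↦ ⟨conjClass Y k y, h₂ y y.2⟩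
      left_inv := fun x ↦ Subtype.ext (conjClass_conjClass _)
      right_inv := fun y ↦ Subtype.ext (conjClass_conjClass _) }
  have h := f.finrank_eq
  rw [← Module.finrank_mul_finrank ℝ ℂ S₁, ← Module.finrank_mul_finrank ℝ ℂ S₂,
    Complex.finrank_real_complex] at h
  omega

end Conj

/-! ### `H^{1,0}` and `H^{0,1}` as subspaces of `H¹(X(ℂ); ℂ)` -/

section Pieces

variable {n : ℕ} {X : Motives.SchemeOver ℂ}

/-- **`H^{1,0}(X) ⊆ H¹(X(ℂ); ℂ)`**, the classes of Hodge type `(1, 0)`, as a `ℂ`-submodule (`X` smooth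
projective of dimension `n`; closed under sums because all Hodge models cut out the same `H^{1,0}`,
`IsOfHodgeType.add`). [cite: VoisinHodgeI2002, §6.1.3 and §7.1.1] -/
def hodgeOneZero (hX : IsSmoothProjective n X) : Submodule ℂ (complexBetti X 1) where
  carrier := {x | IsOfHodgeType n X 1 1 0 x}
  add_mem' ha hb := ha.add hX hb
  zero_mem' := by
    obtain ⟨A⟩ := nonempty_hodgeModel_holds.nonempty hX
    exact ⟨A, by rw [map_zero]; exact Submodule.zero_mem _⟩
  smul_mem' c _ hx := hx.smul c

/-- **`H^{0,1}(X) ⊆ H¹(X(ℂ); ℂ)`**, the classes of Hodge type `(0, 1)`. [cite: VoisinHodgeI2002, §6.1.3 and §7.1.1] -/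
def hodgeZeroOne (hX : IsSmoothProjective n X) : Submodule ℂ (complexBetti X 1) where
  carrier := {x | IsOfHodgeType n X 1 0 1 x}
  add_mem' ha hb := ha.add hX hb
  zero_mem' := by
    obtain ⟨A⟩ := nonempty_hodgeModel_holds.nonempty hX
    exact ⟨A, by rw [map_zero]; exact Submodule.zero_mem _⟩
  smul_mem' c _ hx := hx.smul c

variable (hX : IsSmoothProjective n X)

/-- Membership in `hodgeOneZero` is `IsOfHodgeType n X 1 1 0`. [folklore] -/
@[simp]
theorem mem_hodgeOneZero {x : complexBetti X 1} : x ∈ hodgeOneZero hX ↔ IsOfHodgeType n X 1 1 0 x :=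
  Iff.rfl

/-- Membership in `hodgeZeroOne` is `IsOfHodgeType n X 1 0 1`. [folklore] -/
@[simp]
theorem mem_hodgeZeroOne {x : complexBetti X 1} : x ∈ hodgeZeroOne hX ↔ IsOfHodgeType n X 1 0 1 x :=
  Iff.rfl

/-- **`H¹ = H^{1,0} ⊕ H^{0,1}`** on `H¹(X(ℂ); ℂ)` (the Hodge decomposition in degree one: every
class is a sum of a `(1,0)`- and a `(0,1)`-class, and a class of both types is zero).
[cite: VoisinHodgeI2002, §6.1.3 and Cor. 6.14] -/
theorem isCompl_hodgeOneZero_hodgeZeroOne : IsCompl (hodgeOneZero hX) (hodgeZeroOne hX) := by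
  refine ⟨Submodule.disjoint_def.2 fun x h1 h2 ↦ eq_zero_of_isOfHodgeType_one_zero_of_zero_one hX h1 h2,
    codisjoint_iff.2 (eq_top_iff.2 fun x _ ↦ ?_)⟩
  obtain ⟨a, b, hab, ha, hb⟩ := exists_add_eq_of_isOfHodgeType_one hX x
  rw [← hab]
  exact Submodule.add_mem_sup ha hb

/-- `H^{1,0} ∩ H^{0,1} = 0`. [cite: VoisinHodgeI2002, Cor. 6.14] -/
theorem hodgeOneZero_inf_hodgeZeroOne : hodgeOneZero hX ⊓ hodgeZeroOne hX = ⊥ :=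
  (isCompl_hodgeOneZero_hodgeZeroOne hX).inf_eq_bot

variable (g : X ⟶ X)

/-- `g^*` preserves `H^{1,0}` (pull-backs preserve Hodge types). [cite: VoisinHodgeI2002, §7.3.2] -/
theorem map_mem_hodgeOneZero {x : complexBetti X 1} (hx : x ∈ hodgeOneZero hX) :
    (complexBetti.map g 1).hom x ∈ hodgeOneZero hX :=
  IsOfHodgeType.map_of_isSmoothProjective hx hX hX g

/-- `g^*` preserves `H^{0,1}`. [cite: VoisinHodgeI2002, §7.3.2] -/
theorem map_mem_hodgeZeroOne {x : complexBetti X 1} (hx : x ∈ hodgeZeroOne hX) :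
    (complexBetti.map g 1).hom x ∈ hodgeZeroOne hX :=
  IsOfHodgeType.map_of_isSmoothProjective hx hX hX g

/-- Conjugation maps `H^{1,0}` into `H^{0,1}`. [cite: VoisinHodgeI2002, §6.1.3 Cor. 6.12] -/
theorem conjClass_mem_hodgeZeroOne {x : complexBetti X 1} (hx : x ∈ hodgeOneZero hX) :
    conjClass (Motives.ComplexPoints X) 1 x ∈ hodgeZeroOne hX :=
  IsOfHodgeType.conjClass hX hx

/-- Conjugation maps `H^{0,1}` into `H^{1,0}`. [cite: VoisinHodgeI2002, §6.1.3 Cor. 6.12] -/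
theorem conjClass_mem_hodgeOneZero {x : complexBetti X 1} (hx : x ∈ hodgeZeroOne hX) :
    conjClass (Motives.ComplexPoints X) 1 x ∈ hodgeOneZero hX :=
  IsOfHodgeType.conjClass hX hx

/-! ### Eigenvectors of `g^*` and the multiplicities `p_μ`, `q_μ` -/

/-- **The `(1,0)`- and `(0,1)`-components of an eigenvector of `g^*` are eigenvectors** for the same
eigenvalue: `(g^*a - μa) + (g^*b - μb) = 0` with the two summands of different types (`g^*`
preserves types), hence both zero (Cor. 6.14). The step "`H^{1,0} = W₊^{1,0} ⊕ W₋^{1,0}`" of van Geemen's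
Lemma 5.2. [cite: VoisinHodgeI2002, §7.3.2 and Cor. 6.14] [cite: vanGeemen1994HodgeAV, proof of Lemma 5.2] -/
theorem eigenvector_components (μ : ℂ) {v a b : complexBetti X 1}
    (hv : (complexBetti.map g 1).hom v = μ • v) (hab : a + b = v) (ha : a ∈ hodgeOneZero hX)
    (hb : b ∈ hodgeZeroOne hX) :
    (complexBetti.map g 1).hom a = μ • a ∧ (complexBetti.map g 1).hom b = μ • b := by
  set G := (complexBetti.map g 1).hom with hG
  have hsum : (G a - μ • a) + (G b - μ • b) = 0 := by
    have h1 : G a + G b = μ • a + μ • b := by rw [← map_add, ← smul_add, hab, hv]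
    calc (G a - μ • a) + (G b - μ • b) = (G a + G b) - (μ • a + μ • b) := by abel
      _ = 0 := by rw [h1, sub_self]
  have h1 : G a - μ • a ∈ hodgeOneZero hX :=
    Submodule.sub_mem _ (map_mem_hodgeOneZero hX g ha) (Submodule.smul_mem _ μ ha)
  have h2 : G b - μ • b ∈ hodgeZeroOne hX :=
    Submodule.sub_mem _ (map_mem_hodgeZeroOne hX g hb) (Submodule.smul_mem _ μ hb)
  have heq : G a - μ • a = -(G b - μ • b) := eq_neg_of_add_eq_zero_left hsum
  have h1' : G a - μ • a ∈ hodgeZeroOne hX := by rw [heq]; exact Submodule.neg_mem _ h2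
  have hza : G a - μ • a = 0 := eq_zero_of_isOfHodgeType_one_zero_of_zero_one hX h1 h1'
  have hzb : G b - μ • b = 0 := by rw [hza, zero_add] at hsum; exact hsum
  exact ⟨sub_eq_zero.1 hza, sub_eq_zero.1 hzb⟩

/-- **`V_μ = (V_μ ∩ H^{1,0}) ⊕ (V_μ ∩ H^{0,1})`** for the eigenspace `V_μ` of `g^*` on `H¹(X(ℂ); ℂ)`.
[cite: vanGeemen1994HodgeAV, 4.9 and proof of Lemma 5.2] -/
theorem eigenspace_eq_sup (μ : ℂ) :
    Module.End.eigenspace (complexBetti.map g 1).hom μ =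
      Module.End.eigenspace (complexBetti.map g 1).hom μ ⊓ hodgeOneZero hX ⊔
        Module.End.eigenspace (complexBetti.map g 1).hom μ ⊓ hodgeZeroOne hX := by
  refine le_antisymm (fun v hv ↦ ?_) (sup_le inf_le_left inf_le_left)
  obtain ⟨a, b, hab, ha, hb⟩ := exists_add_eq_of_isOfHodgeType_one hX v
  obtain ⟨hga, hgb⟩ := eigenvector_components hX g μ (Module.End.mem_eigenspace_iff.1 hv) hab ha hb
  rw [← hab]
  exact Submodule.add_mem_sup ⟨Module.End.mem_eigenspace_iff.2 hga, ha⟩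
    ⟨Module.End.mem_eigenspace_iff.2 hgb, hb⟩

/-- **`dim V_μ = p_μ + q_μ`**, `p_μ = dim (V_μ ∩ H^{1,0})`, `q_μ = dim (V_μ ∩ H^{0,1})` (the
`K`-multiplicities of van Geemen 4.9). [cite: vanGeemen1994HodgeAV, 4.9] -/
theorem finrank_eigenspace_eq_add [Module.Finite ℂ (complexBetti X 1)] (μ : ℂ) :
    Module.finrank ℂ (Module.End.eigenspace (complexBetti.map g 1).hom μ) =
      Module.finrank ℂ ↥(Module.End.eigenspace (complexBetti.map g 1).hom μ ⊓ hodgeOneZero hX) +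
        Module.finrank ℂ ↥(Module.End.eigenspace (complexBetti.map g 1).hom μ ⊓ hodgeZeroOne hX) := by
  have h := Submodule.finrank_sup_add_finrank_inf_eq
    (Module.End.eigenspace (complexBetti.map g 1).hom μ ⊓ hodgeOneZero hX)
    (Module.End.eigenspace (complexBetti.map g 1).hom μ ⊓ hodgeZeroOne hX)
  have hinf : Module.End.eigenspace (complexBetti.map g 1).hom μ ⊓ hodgeOneZero hX ⊓
      (Module.End.eigenspace (complexBetti.map g 1).hom μ ⊓ hodgeZeroOne hX) = ⊥ := by
    rw [eq_bot_iff]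
    rintro x ⟨⟨-, h1⟩, -, h2⟩
    rw [Submodule.mem_bot]
    exact eq_zero_of_isOfHodgeType_one_zero_of_zero_one hX h1 h2
  rw [← eigenspace_eq_sup hX g μ, hinf, finrank_bot, add_zero] at h
  exact h

/-- **`q_{μ̄} = p_μ`**: conjugation maps `V_μ ∩ H^{1,0}` bijectively onto `V_{conj μ} ∩ H^{0,1}` (`g^*`
commutes with conjugation, `conjClass_map`), so the two have the same dimension.
[cite: vanGeemen1994HodgeAV, 4.9] [cite: VoisinHodgeI2002, §6.1.3 Cor. 6.12] -/
theorem finrank_eigenspace_inf_hodgeZeroOne_eq [Module.Finite ℂ (complexBetti X 1)] (μ : ℂ) :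
    Module.finrank ℂ ↥(Module.End.eigenspace (complexBetti.map g 1).hom ((starRingEnd ℂ) μ) ⊓ hodgeZeroOne hX) =
      Module.finrank ℂ ↥(Module.End.eigenspace (complexBetti.map g 1).hom μ ⊓ hodgeOneZero hX) := by
  symm
  have hT : ∀ x : complexBetti X 1, conjClass (Motives.ComplexPoints X) 1 ((complexBetti.map g 1).hom x) =
      (complexBetti.map g 1).hom (conjClass (Motives.ComplexPoints X) 1 x) :=
    fun x ↦ conjClass_map _ x
  refine finrank_eq_of_conjClass_mapsTo _ _ (fun x hx ↦ ?_) (fun x hx ↦ ?_)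
  · obtain ⟨hx1, hx2⟩ := hx
    refine ⟨Module.End.mem_eigenspace_iff.2 ?_, conjClass_mem_hodgeZeroOne hX hx2⟩
    rw [← hT, Module.End.mem_eigenspace_iff.1 hx1, conjClass_smul]
  · obtain ⟨hx1, hx2⟩ := hx
    refine ⟨Module.End.mem_eigenspace_iff.2 ?_, conjClass_mem_hodgeOneZero hX hx2⟩
    rw [← hT, Module.End.mem_eigenspace_iff.1 hx1, conjClass_smul, Complex.conj_conj]

end Pieces

/-! ### Products: the multiplicities add -/

section Products

variable {A B : Motives.AbelianVariety ℂ} {mA mB : ℕ} (hA : A.dim = mA) (hB : B.dim = mB)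
  (φ : A ⟶ A) (ψ : B ⟶ B)

/-- `pr_A^* a + pr_B^* b = 0` forces `a = 0` and `b = 0` (apply the sections `(𝟙, 0)`, `(0, 𝟙)`).
[cite: HatcherAT2002, §3.2 Thm. 3.16] -/
theorem eq_zero_of_map_fst_add_map_snd_eq_zero {a : complexBetti A.X 1} {b : complexBetti B.X 1}
    (h : (complexBetti.map (Motives.AbelianVariety.fst A B).hom.hom.hom 1).hom a + (complexBetti.map (Motives.AbelianVariety.snd A B).hom.hom.hom 1).hom b = 0) : a = 0 ∧ b = 0 := by
  constructor
  · have h1 := congrArg (complexBetti.map (Motives.AbelianVariety.prodLift (𝟙 A) (0 : A ⟶ B)).hom.hom.hom 1) h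
    rw [map_add, map_zero] at h1
    change complexBetti.map _ 1 (complexBetti.map _ 1 a) + complexBetti.map _ 1 (complexBetti.map _ 1 b) = 0 at h1
    rwa [Motives.map_inlSection_map_fst_one, Motives.map_inlSection_map_snd_one, add_zero] at h1
  · have h1 := congrArg (complexBetti.map (Motives.AbelianVariety.prodLift (0 : B ⟶ A) (𝟙 B)).hom.hom.hom 1) h
    rw [map_add, map_zero] at h1
    change complexBetti.map _ 1 (complexBetti.map _ 1 a) + complexBetti.map _ 1 (complexBetti.map _ 1 b) = 0 at h1
    rwa [Motives.map_inrSection_map_fst_one, Motives.map_inrSection_map_snd_one, zero_add] at h1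

/-- `pr_A^*` is injective on `H¹`. [folklore] -/
theorem map_fst_injective_one : Function.Injective (complexBetti.map (Motives.AbelianVariety.fst A B).hom.hom.hom 1).hom := by
  intro a a' h
  have h0 : (complexBetti.map (Motives.AbelianVariety.fst A B).hom.hom.hom 1).hom (a - a') + (complexBetti.map (Motives.AbelianVariety.snd A B).hom.hom.hom 1).hom 0 = 0 := by rw [map_sub, map_zero, add_zero, h, sub_self]
  exact sub_eq_zero.1 (eq_zero_of_map_fst_add_map_snd_eq_zero h0).1

/-- `pr_B^*` is injective on `H¹`. [folklore] -/
theorem map_snd_injective_one : Function.Injective (complexBetti.map (Motives.AbelianVariety.snd A B).hom.hom.hom 1).hom := by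
  intro b b' h
  have h0 : (complexBetti.map (Motives.AbelianVariety.fst A B).hom.hom.hom 1).hom 0 + (complexBetti.map (Motives.AbelianVariety.snd A B).hom.hom.hom 1).hom (b - b') = 0 := by rw [map_sub, map_zero, zero_add, h, sub_self]
  exact sub_eq_zero.1 (eq_zero_of_map_fst_add_map_snd_eq_zero h0).2

/-- The images `pr_A^* S` and `pr_B^* T` are disjoint in `H¹((A × B)(ℂ); ℂ)`. [cite: HatcherAT2002, §3.2 Thm. 3.16] -/
theorem disjoint_map_fst_map_snd (S : Submodule ℂ (complexBetti A.X 1)) (T : Submodule ℂ (complexBetti B.X 1)) :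
    Disjoint (S.map (complexBetti.map (Motives.AbelianVariety.fst A B).hom.hom.hom 1).hom) (T.map (complexBetti.map (Motives.AbelianVariety.snd A B).hom.hom.hom 1).hom) := by
  rw [Submodule.disjoint_def]
  rintro z ⟨a, -, rfl⟩ ⟨b, -, hb⟩
  have h0 : (complexBetti.map (Motives.AbelianVariety.fst A B).hom.hom.hom 1).hom a + (complexBetti.map (Motives.AbelianVariety.snd A B).hom.hom.hom 1).hom (-b) = 0 := by rw [map_neg, ← hb, add_neg_cancel]
  rw [(eq_zero_of_map_fst_add_map_snd_eq_zero h0).1, map_zero]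

include hA hB

/-- **`V_μ(A × B) ∩ H^{1,0}(A × B) = pr_A^*(V_μ(A) ∩ H^{1,0}(A)) ⊕ pr_B^*(V_μ(B) ∩ H^{1,0}(B))`** for
`φ × ψ` (Künneth in degree one with Hodge types: `H¹(A × B) = pr_A^* H¹(A) ⊕ pr_B^* H¹(B)`, the
pull-backs preserve types and `(φ × ψ)^*` acts diagonally). [cite: VoisinHodgeI2002, §7.3.2 and §11.3.3]
[cite: vanGeemen1994HodgeAV, proof of Lemma 5.2 (3)] -/
theorem eigenspace_inf_hodgeOneZero_prod_eq_sup (μ : ℂ) :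
    Module.End.eigenspace (complexBetti.map (Motives.AbelianVariety.prodLift (Motives.AbelianVariety.fst A B ≫ φ) (Motives.AbelianVariety.snd A B ≫ ψ)).hom.hom.hom 1).hom μ ⊓ hodgeOneZero (Motives.isSmoothProjective_of_dim_eq'
        (show (A.prod B).dim = mA + mB by rw [Motives.AbelianVariety.dim_prod, hA, hB])) =
      (Module.End.eigenspace (complexBetti.map φ.hom.hom.hom 1).hom μ ⊓ hodgeOneZero (Motives.isSmoothProjective_of_dim_eq' hA)).map (complexBetti.map (Motives.AbelianVariety.fst A B).hom.hom.hom 1).hom ⊔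
        (Module.End.eigenspace (complexBetti.map ψ.hom.hom.hom 1).hom μ ⊓ hodgeOneZero (Motives.isSmoothProjective_of_dim_eq' hB)).map (complexBetti.map (Motives.AbelianVariety.snd A B).hom.hom.hom 1).hom := by
  have hAs := Motives.isSmoothProjective_of_dim_eq' hA
  have hBs := Motives.isSmoothProjective_of_dim_eq' hB
  have hXs : IsSmoothProjective (mA + mB) (A.prod B).X := Motives.isSmoothProjective_of_dim_eq'
    (show (A.prod B).dim = mA + mB by rw [Motives.AbelianVariety.dim_prod, hA, hB])
  refine le_antisymm ?_ ?_
  · rintro x ⟨hxμ, hx10⟩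
    rw [SetLike.mem_coe, Module.End.mem_eigenspace_iff] at hxμ
    obtain ⟨a, b, hab⟩ := exists_eq_map_fst_add_map_snd_deg_one hAs hBs x
    change x = (complexBetti.map (Motives.AbelianVariety.fst A B).hom.hom.hom 1).hom a + (complexBetti.map (Motives.AbelianVariety.snd A B).hom.hom.hom 1).hom b at hab
    -- types: `a ∈ H^{1,0}(A)`, `b ∈ H^{1,0}(B)`
    obtain ⟨a₁, a₂, ha, ha₁, ha₂⟩ := exists_add_eq_of_isOfHodgeType_one hAs a
    obtain ⟨b₁, b₂, hb, hb₁, hb₂⟩ := exists_add_eq_of_isOfHodgeType_one hBs b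
    have h10 : (complexBetti.map (Motives.AbelianVariety.fst A B).hom.hom.hom 1).hom a₁ + (complexBetti.map (Motives.AbelianVariety.snd A B).hom.hom.hom 1).hom b₁ ∈ hodgeOneZero hXs :=
      Submodule.add_mem _ (IsOfHodgeType.map_of_isSmoothProjective ha₁ hXs hAs _)
        (IsOfHodgeType.map_of_isSmoothProjective hb₁ hXs hBs _)
    have h01 : (complexBetti.map (Motives.AbelianVariety.fst A B).hom.hom.hom 1).hom a₂ + (complexBetti.map (Motives.AbelianVariety.snd A B).hom.hom.hom 1).hom b₂ ∈ hodgeZeroOne hXs :=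
      Submodule.add_mem _ (IsOfHodgeType.map_of_isSmoothProjective ha₂ hXs hAs _)
        (IsOfHodgeType.map_of_isSmoothProjective hb₂ hXs hBs _)
    have hsplit : x = ((complexBetti.map (Motives.AbelianVariety.fst A B).hom.hom.hom 1).hom a₁ + (complexBetti.map (Motives.AbelianVariety.snd A B).hom.hom.hom 1).hom b₁) + ((complexBetti.map (Motives.AbelianVariety.fst A B).hom.hom.hom 1).hom a₂ + (complexBetti.map (Motives.AbelianVariety.snd A B).hom.hom.hom 1).hom b₂) := by
      rw [hab, ← ha, ← hb, map_add, map_add]; abel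
    have h01' : (complexBetti.map (Motives.AbelianVariety.fst A B).hom.hom.hom 1).hom a₂ + (complexBetti.map (Motives.AbelianVariety.snd A B).hom.hom.hom 1).hom b₂ ∈ hodgeOneZero hXs := by
      have h : (complexBetti.map (Motives.AbelianVariety.fst A B).hom.hom.hom 1).hom a₂ + (complexBetti.map (Motives.AbelianVariety.snd A B).hom.hom.hom 1).hom b₂ = x - ((complexBetti.map (Motives.AbelianVariety.fst A B).hom.hom.hom 1).hom a₁ + (complexBetti.map (Motives.AbelianVariety.snd A B).hom.hom.hom 1).hom b₁) := by rw [hsplit]; abel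
      rw [h]
      exact Submodule.sub_mem _ hx10 h10
    have hz : (complexBetti.map (Motives.AbelianVariety.fst A B).hom.hom.hom 1).hom a₂ + (complexBetti.map (Motives.AbelianVariety.snd A B).hom.hom.hom 1).hom b₂ = 0 := eq_zero_of_isOfHodgeType_one_zero_of_zero_one hXs h01' h01
    obtain ⟨ha₂0, hb₂0⟩ := eq_zero_of_map_fst_add_map_snd_eq_zero hz
    rw [ha₂0, add_zero] at ha
    rw [hb₂0, add_zero] at hb
    subst ha hb
    -- eigenvalues: `φ^* a = μ a`, `ψ^* b = μ b`
    have hT : (complexBetti.map (Motives.AbelianVariety.prodLift (Motives.AbelianVariety.fst A B ≫ φ) (Motives.AbelianVariety.snd A B ≫ ψ)).hom.hom.hom 1).hom x = (complexBetti.map (Motives.AbelianVariety.fst A B).hom.hom.hom 1).hom ((complexBetti.map φ.hom.hom.hom 1).hom a₁) + (complexBetti.map (Motives.AbelianVariety.snd A B).hom.hom.hom 1).hom ((complexBetti.map ψ.hom.hom.hom 1).hom b₁) := by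
      rw [hab, map_add]
      change complexBetti.map _ 1 (complexBetti.map _ 1 a₁) + complexBetti.map _ 1 (complexBetti.map _ 1 b₁) = _
      rw [Motives.map_prodLift_map_fst, Motives.map_prodLift_map_snd]
    have hdiff : (complexBetti.map (Motives.AbelianVariety.fst A B).hom.hom.hom 1).hom ((complexBetti.map φ.hom.hom.hom 1).hom a₁ - μ • a₁) + (complexBetti.map (Motives.AbelianVariety.snd A B).hom.hom.hom 1).hom ((complexBetti.map ψ.hom.hom.hom 1).hom b₁ - μ • b₁) = 0 := by
      rw [map_sub, map_sub, map_smul, map_smul]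
      calc (complexBetti.map (Motives.AbelianVariety.fst A B).hom.hom.hom 1).hom ((complexBetti.map φ.hom.hom.hom 1).hom a₁) - μ • (complexBetti.map (Motives.AbelianVariety.fst A B).hom.hom.hom 1).hom a₁ + ((complexBetti.map (Motives.AbelianVariety.snd A B).hom.hom.hom 1).hom ((complexBetti.map ψ.hom.hom.hom 1).hom b₁) - μ • (complexBetti.map (Motives.AbelianVariety.snd A B).hom.hom.hom 1).hom b₁)
          = ((complexBetti.map (Motives.AbelianVariety.fst A B).hom.hom.hom 1).hom ((complexBetti.map φ.hom.hom.hom 1).hom a₁) + (complexBetti.map (Motives.AbelianVariety.snd A B).hom.hom.hom 1).hom ((complexBetti.map ψ.hom.hom.hom 1).hom b₁)) - μ • ((complexBetti.map (Motives.AbelianVariety.fst A B).hom.hom.hom 1).hom a₁ + (complexBetti.map (Motives.AbelianVariety.snd A B).hom.hom.hom 1).hom b₁) := by rw [smul_add]; abel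
        _ = 0 := by rw [← hT, ← hab, hxμ, sub_self]
    obtain ⟨hTa, hTb⟩ := eq_zero_of_map_fst_add_map_snd_eq_zero hdiff
    rw [hab]
    exact Submodule.add_mem_sup ⟨a₁, ⟨Module.End.mem_eigenspace_iff.2 (sub_eq_zero.1 hTa), ha₁⟩, rfl⟩
      ⟨b₁, ⟨Module.End.mem_eigenspace_iff.2 (sub_eq_zero.1 hTb), hb₁⟩, rfl⟩
  · refine sup_le ?_ ?_
    · rintro _ ⟨a, ⟨haμ, ha10⟩, rfl⟩
      refine ⟨Module.End.mem_eigenspace_iff.2 ?_, IsOfHodgeType.map_of_isSmoothProjective ha10 hXs hAs _⟩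
      change complexBetti.map _ 1 (complexBetti.map _ 1 a) = _
      rw [Motives.map_prodLift_map_fst]
      change (complexBetti.map (Motives.AbelianVariety.fst A B).hom.hom.hom 1).hom ((complexBetti.map φ.hom.hom.hom 1).hom a) = μ • (complexBetti.map (Motives.AbelianVariety.fst A B).hom.hom.hom 1).hom a
      rw [Module.End.mem_eigenspace_iff.1 haμ, map_smul]
    · rintro _ ⟨b, ⟨hbμ, hb10⟩, rfl⟩
      refine ⟨Module.End.mem_eigenspace_iff.2 ?_, IsOfHodgeType.map_of_isSmoothProjective hb10 hXs hBs _⟩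
      change complexBetti.map _ 1 (complexBetti.map _ 1 b) = _
      rw [Motives.map_prodLift_map_snd]
      change (complexBetti.map (Motives.AbelianVariety.snd A B).hom.hom.hom 1).hom ((complexBetti.map ψ.hom.hom.hom 1).hom b) = μ • (complexBetti.map (Motives.AbelianVariety.snd A B).hom.hom.hom 1).hom b
      rw [Module.End.mem_eigenspace_iff.1 hbμ, map_smul]

/-- The `(0,1)` twin: **`V_μ(A × B) ∩ H^{0,1}(A × B) = pr_A^*(V_μ(A) ∩ H^{0,1}(A)) ⊕ pr_B^*(V_μ(B) ∩ H^{0,1}(B))`**.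
[cite: VoisinHodgeI2002, §7.3.2 and §11.3.3] -/
theorem eigenspace_inf_hodgeZeroOne_prod_eq_sup (μ : ℂ) :
    Module.End.eigenspace (complexBetti.map (Motives.AbelianVariety.prodLift (Motives.AbelianVariety.fst A B ≫ φ) (Motives.AbelianVariety.snd A B ≫ ψ)).hom.hom.hom 1).hom μ ⊓ hodgeZeroOne (Motives.isSmoothProjective_of_dim_eq'
        (show (A.prod B).dim = mA + mB by rw [Motives.AbelianVariety.dim_prod, hA, hB])) =
      (Module.End.eigenspace (complexBetti.map φ.hom.hom.hom 1).hom μ ⊓ hodgeZeroOne (Motives.isSmoothProjective_of_dim_eq' hA)).map (complexBetti.map (Motives.AbelianVariety.fst A B).hom.hom.hom 1).hom ⊔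
        (Module.End.eigenspace (complexBetti.map ψ.hom.hom.hom 1).hom μ ⊓ hodgeZeroOne (Motives.isSmoothProjective_of_dim_eq' hB)).map (complexBetti.map (Motives.AbelianVariety.snd A B).hom.hom.hom 1).hom := by
  have hAs := Motives.isSmoothProjective_of_dim_eq' hA
  have hBs := Motives.isSmoothProjective_of_dim_eq' hB
  have hXs : IsSmoothProjective (mA + mB) (A.prod B).X := Motives.isSmoothProjective_of_dim_eq'
    (show (A.prod B).dim = mA + mB by rw [Motives.AbelianVariety.dim_prod, hA, hB])
  refine le_antisymm ?_ ?_
  · rintro x ⟨hxμ, hx01⟩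
    rw [SetLike.mem_coe, Module.End.mem_eigenspace_iff] at hxμ
    obtain ⟨a, b, hab⟩ := exists_eq_map_fst_add_map_snd_deg_one hAs hBs x
    change x = (complexBetti.map (Motives.AbelianVariety.fst A B).hom.hom.hom 1).hom a + (complexBetti.map (Motives.AbelianVariety.snd A B).hom.hom.hom 1).hom b at hab
    obtain ⟨a₁, a₂, ha, ha₁, ha₂⟩ := exists_add_eq_of_isOfHodgeType_one hAs a
    obtain ⟨b₁, b₂, hb, hb₁, hb₂⟩ := exists_add_eq_of_isOfHodgeType_one hBs b
    have h10 : (complexBetti.map (Motives.AbelianVariety.fst A B).hom.hom.hom 1).hom a₁ + (complexBetti.map (Motives.AbelianVariety.snd A B).hom.hom.hom 1).hom b₁ ∈ hodgeOneZero hXs :=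
      Submodule.add_mem _ (IsOfHodgeType.map_of_isSmoothProjective ha₁ hXs hAs _)
        (IsOfHodgeType.map_of_isSmoothProjective hb₁ hXs hBs _)
    have h01 : (complexBetti.map (Motives.AbelianVariety.fst A B).hom.hom.hom 1).hom a₂ + (complexBetti.map (Motives.AbelianVariety.snd A B).hom.hom.hom 1).hom b₂ ∈ hodgeZeroOne hXs :=
      Submodule.add_mem _ (IsOfHodgeType.map_of_isSmoothProjective ha₂ hXs hAs _)
        (IsOfHodgeType.map_of_isSmoothProjective hb₂ hXs hBs _)
    have hsplit : x = ((complexBetti.map (Motives.AbelianVariety.fst A B).hom.hom.hom 1).hom a₁ + (complexBetti.map (Motives.AbelianVariety.snd A B).hom.hom.hom 1).hom b₁) + ((complexBetti.map (Motives.AbelianVariety.fst A B).hom.hom.hom 1).hom a₂ + (complexBetti.map (Motives.AbelianVariety.snd A B).hom.hom.hom 1).hom b₂) := by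
      rw [hab, ← ha, ← hb, map_add, map_add]; abel
    have h10' : (complexBetti.map (Motives.AbelianVariety.fst A B).hom.hom.hom 1).hom a₁ + (complexBetti.map (Motives.AbelianVariety.snd A B).hom.hom.hom 1).hom b₁ ∈ hodgeZeroOne hXs := by
      have h : (complexBetti.map (Motives.AbelianVariety.fst A B).hom.hom.hom 1).hom a₁ + (complexBetti.map (Motives.AbelianVariety.snd A B).hom.hom.hom 1).hom b₁ = x - ((complexBetti.map (Motives.AbelianVariety.fst A B).hom.hom.hom 1).hom a₂ + (complexBetti.map (Motives.AbelianVariety.snd A B).hom.hom.hom 1).hom b₂) := by rw [hsplit]; abel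
      rw [h]
      exact Submodule.sub_mem _ hx01 h01
    have hz : (complexBetti.map (Motives.AbelianVariety.fst A B).hom.hom.hom 1).hom a₁ + (complexBetti.map (Motives.AbelianVariety.snd A B).hom.hom.hom 1).hom b₁ = 0 := eq_zero_of_isOfHodgeType_one_zero_of_zero_one hXs h10 h10'
    obtain ⟨ha₁0, hb₁0⟩ := eq_zero_of_map_fst_add_map_snd_eq_zero hz
    rw [ha₁0, zero_add] at ha
    rw [hb₁0, zero_add] at hb
    subst ha hb
    have hT : (complexBetti.map (Motives.AbelianVariety.prodLift (Motives.AbelianVariety.fst A B ≫ φ) (Motives.AbelianVariety.snd A B ≫ ψ)).hom.hom.hom 1).hom x = (complexBetti.map (Motives.AbelianVariety.fst A B).hom.hom.hom 1).hom ((complexBetti.map φ.hom.hom.hom 1).hom a₂) + (complexBetti.map (Motives.AbelianVariety.snd A B).hom.hom.hom 1).hom ((complexBetti.map ψ.hom.hom.hom 1).hom b₂) := by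
      rw [hab, map_add]
      change complexBetti.map _ 1 (complexBetti.map _ 1 a₂) + complexBetti.map _ 1 (complexBetti.map _ 1 b₂) = _
      rw [Motives.map_prodLift_map_fst, Motives.map_prodLift_map_snd]
    have hdiff : (complexBetti.map (Motives.AbelianVariety.fst A B).hom.hom.hom 1).hom ((complexBetti.map φ.hom.hom.hom 1).hom a₂ - μ • a₂) + (complexBetti.map (Motives.AbelianVariety.snd A B).hom.hom.hom 1).hom ((complexBetti.map ψ.hom.hom.hom 1).hom b₂ - μ • b₂) = 0 := by
      rw [map_sub, map_sub, map_smul, map_smul]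
      calc (complexBetti.map (Motives.AbelianVariety.fst A B).hom.hom.hom 1).hom ((complexBetti.map φ.hom.hom.hom 1).hom a₂) - μ • (complexBetti.map (Motives.AbelianVariety.fst A B).hom.hom.hom 1).hom a₂ + ((complexBetti.map (Motives.AbelianVariety.snd A B).hom.hom.hom 1).hom ((complexBetti.map ψ.hom.hom.hom 1).hom b₂) - μ • (complexBetti.map (Motives.AbelianVariety.snd A B).hom.hom.hom 1).hom b₂)
          = ((complexBetti.map (Motives.AbelianVariety.fst A B).hom.hom.hom 1).hom ((complexBetti.map φ.hom.hom.hom 1).hom a₂) + (complexBetti.map (Motives.AbelianVariety.snd A B).hom.hom.hom 1).hom ((complexBetti.map ψ.hom.hom.hom 1).hom b₂)) - μ • ((complexBetti.map (Motives.AbelianVariety.fst A B).hom.hom.hom 1).hom a₂ + (complexBetti.map (Motives.AbelianVariety.snd A B).hom.hom.hom 1).hom b₂) := by rw [smul_add]; abel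
        _ = 0 := by rw [← hT, ← hab, hxμ, sub_self]
    obtain ⟨hTa, hTb⟩ := eq_zero_of_map_fst_add_map_snd_eq_zero hdiff
    rw [hab]
    exact Submodule.add_mem_sup ⟨a₂, ⟨Module.End.mem_eigenspace_iff.2 (sub_eq_zero.1 hTa), ha₂⟩, rfl⟩
      ⟨b₂, ⟨Module.End.mem_eigenspace_iff.2 (sub_eq_zero.1 hTb), hb₂⟩, rfl⟩
  · refine sup_le ?_ ?_
    · rintro _ ⟨a, ⟨haμ, ha01⟩, rfl⟩
      refine ⟨Module.End.mem_eigenspace_iff.2 ?_, IsOfHodgeType.map_of_isSmoothProjective ha01 hXs hAs _⟩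
      change complexBetti.map _ 1 (complexBetti.map _ 1 a) = _
      rw [Motives.map_prodLift_map_fst]
      change (complexBetti.map (Motives.AbelianVariety.fst A B).hom.hom.hom 1).hom ((complexBetti.map φ.hom.hom.hom 1).hom a) = μ • (complexBetti.map (Motives.AbelianVariety.fst A B).hom.hom.hom 1).hom a
      rw [Module.End.mem_eigenspace_iff.1 haμ, map_smul]
    · rintro _ ⟨b, ⟨hbμ, hb01⟩, rfl⟩
      refine ⟨Module.End.mem_eigenspace_iff.2 ?_, IsOfHodgeType.map_of_isSmoothProjective hb01 hXs hBs _⟩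
      change complexBetti.map _ 1 (complexBetti.map _ 1 b) = _
      rw [Motives.map_prodLift_map_snd]
      change (complexBetti.map (Motives.AbelianVariety.snd A B).hom.hom.hom 1).hom ((complexBetti.map ψ.hom.hom.hom 1).hom b) = μ • (complexBetti.map (Motives.AbelianVariety.snd A B).hom.hom.hom 1).hom b
      rw [Module.End.mem_eigenspace_iff.1 hbμ, map_smul]

/-- **The multiplicities add: `p_μ(A × B) = p_μ(A) + p_μ(B)`** (`dim` of a disjoint sup of injective
images). [cite: vanGeemen1994HodgeAV, proof of Lemma 5.2 (3)] -/
theorem finrank_eigenspace_inf_hodgeOneZero_prod (μ : ℂ) :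
    Module.finrank ℂ ↥(Module.End.eigenspace (complexBetti.map (Motives.AbelianVariety.prodLift (Motives.AbelianVariety.fst A B ≫ φ) (Motives.AbelianVariety.snd A B ≫ ψ)).hom.hom.hom 1).hom μ ⊓ hodgeOneZero (Motives.isSmoothProjective_of_dim_eq'
        (show (A.prod B).dim = mA + mB by rw [Motives.AbelianVariety.dim_prod, hA, hB]))) =
      Module.finrank ℂ ↥(Module.End.eigenspace (complexBetti.map φ.hom.hom.hom 1).hom μ ⊓ hodgeOneZero (Motives.isSmoothProjective_of_dim_eq' hA)) +
        Module.finrank ℂ ↥(Module.End.eigenspace (complexBetti.map ψ.hom.hom.hom 1).hom μ ⊓ hodgeOneZero (Motives.isSmoothProjective_of_dim_eq' hB)) := by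
  haveI := finite_complexBetti_abelianVariety (A.prod B) 1
  haveI := finite_complexBetti_abelianVariety A 1
  haveI := finite_complexBetti_abelianVariety B 1
  rw [eigenspace_inf_hodgeOneZero_prod_eq_sup hA hB φ ψ μ]
  have h := Submodule.finrank_sup_add_finrank_inf_eq
    ((Module.End.eigenspace (complexBetti.map φ.hom.hom.hom 1).hom μ ⊓ hodgeOneZero (Motives.isSmoothProjective_of_dim_eq' hA)).map (complexBetti.map (Motives.AbelianVariety.fst A B).hom.hom.hom 1).hom)
    ((Module.End.eigenspace (complexBetti.map ψ.hom.hom.hom 1).hom μ ⊓ hodgeOneZero (Motives.isSmoothProjective_of_dim_eq' hB)).map (complexBetti.map (Motives.AbelianVariety.snd A B).hom.hom.hom 1).hom)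
  rw [(disjoint_map_fst_map_snd _ _).eq_bot, finrank_bot, add_zero] at h
  rw [h, ← (Submodule.equivMapOfInjective _ map_fst_injective_one _).finrank_eq,
    ← (Submodule.equivMapOfInjective _ map_snd_injective_one _).finrank_eq]

/-- **`q_μ(A × B) = q_μ(A) + q_μ(B)`** (the `(0,1)` twin). [cite: vanGeemen1994HodgeAV, proof of Lemma 5.2 (3)] -/
theorem finrank_eigenspace_inf_hodgeZeroOne_prod (μ : ℂ) :
    Module.finrank ℂ ↥(Module.End.eigenspace (complexBetti.map (Motives.AbelianVariety.prodLift (Motives.AbelianVariety.fst A B ≫ φ) (Motives.AbelianVariety.snd A B ≫ ψ)).hom.hom.hom 1).hom μ ⊓ hodgeZeroOne (Motives.isSmoothProjective_of_dim_eq'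
        (show (A.prod B).dim = mA + mB by rw [Motives.AbelianVariety.dim_prod, hA, hB]))) =
      Module.finrank ℂ ↥(Module.End.eigenspace (complexBetti.map φ.hom.hom.hom 1).hom μ ⊓ hodgeZeroOne (Motives.isSmoothProjective_of_dim_eq' hA)) +
        Module.finrank ℂ ↥(Module.End.eigenspace (complexBetti.map ψ.hom.hom.hom 1).hom μ ⊓ hodgeZeroOne (Motives.isSmoothProjective_of_dim_eq' hB)) := by
  haveI := finite_complexBetti_abelianVariety (A.prod B) 1
  haveI := finite_complexBetti_abelianVariety A 1
  haveI := finite_complexBetti_abelianVariety B 1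
  rw [eigenspace_inf_hodgeZeroOne_prod_eq_sup hA hB φ ψ μ]
  have h := Submodule.finrank_sup_add_finrank_inf_eq
    ((Module.End.eigenspace (complexBetti.map φ.hom.hom.hom 1).hom μ ⊓ hodgeZeroOne (Motives.isSmoothProjective_of_dim_eq' hA)).map (complexBetti.map (Motives.AbelianVariety.fst A B).hom.hom.hom 1).hom)
    ((Module.End.eigenspace (complexBetti.map ψ.hom.hom.hom 1).hom μ ⊓ hodgeZeroOne (Motives.isSmoothProjective_of_dim_eq' hB)).map (complexBetti.map (Motives.AbelianVariety.snd A B).hom.hom.hom 1).hom)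
  rw [(disjoint_map_fst_map_snd _ _).eq_bot, finrank_bot, add_zero] at h
  rw [h, ← (Submodule.equivMapOfInjective _ map_fst_injective_one _).finrank_eq,
    ← (Submodule.equivMapOfInjective _ map_snd_injective_one _).finrank_eq]

end Products

end HodgeTheory

end Literature.AlgebraicGeometry.HodgeTheory

end
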